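import Literature.Probability.RandomPlanarGeometry.SAWWidePolygonsFromPolygons
import Literature.Probability.RandomPlanarGeometry.BDGS2012CountBoundsProofs
import Mathlib.Analysis.SpecificLimits.Basic
import HarnessLib

/-!
# Subsequential abundance of wide self-avoiding polygons on `ℤ²` (DGHM20 Proposition 3.1)

Topic `Literature/Probability/RandomPlanarGeometry` (polishes the raw composite
`frequently_sq_lower_le_widePolygons` of `SAWWidePolygonsFromPolygons.lean` into the printed shape).

Source: H. Duminil-Copin, S. Ganguly, A. Hammond, I. Manolescu, *Bounding the number of
self-avoiding walks: Hammersley–Welsh with polygon insertion*, Ann. Probab. 48 (2020),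
arXiv:1809.00760, Proposition 3.1 (Subsequential abundance of polygons for `ℤ²`): "For any `α > 29`,
there exists an infinite set `A ⊂ ℕ` such that, for all `u ∈ A` there exists
`m ∈ ⟦4u+4, 4u²+4⟧` for which `|WSAP^u_m| ≥ u^{-α} μ^m`."

## Contents (namespace `Literature.Probability.RandomPlanarGeometry.SAW`), PROVED

* `frequently_widePolygons_abundant` — **Proposition 3.1 with crude constants**: for infinitely many
  `u` there is an even `m` with `u ≤ m + 1`, `m ≤ 2(u+1)²` and `u^{-67} μ^m ≤ |WSAP^u_m|`
  (unconditional: Kesten's bridge divergence → bridges → rooted polygons → polygon classes → dyadic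
  diameter class + rotation → the join).

## Design choices

* Exponent `67` and the window `u ≤ m + 1 ≤ 2(u+1)² + 1` replace the source's `α > 29` and
  `⟦4u+4, 4u²+4⟧`: the tree's Theorem 3.2.4 has a cruder polynomial than Lemma 1.6, the join is counted
  with a lossy injectivity, and dyadic classes are indexed by `log₂(diam+1)`; only the orders matter.
-/

noncomputable section

open Finset Filter Literature.Probability.LatticeModels Literature.Probability.Percolation

namespace Literature.Probability.RandomPlanarGeometry.SAW

/-- `2 ≤ μ(ℤ²) ≤ 3` (BDGS (1.13)). [cite: BDGS2012, §1.3, eq. (1.13)] -/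
private theorem two_le_mu_le_three :
    (2 : ℝ) ≤ Zd.connectiveConstant 2 ∧ Zd.connectiveConstant 2 ≤ 3 := by
  have h := Zd.BDGS2012_connectiveConstant_bounds_holds 2 (by norm_num)
  norm_num at h
  exact ⟨h.1, by linarith [h.2]⟩

/-- Exponential beats polynomial: eventually `c · M^30 ≤ 16^M`. [folklore] -/
private theorem eventually_poly_le_sixteen_pow (c : ℝ) :
    ∀ᶠ M : ℕ in atTop, c * (M : ℝ) ^ 30 ≤ (16 : ℝ) ^ M := by
  have h := tendsto_pow_const_div_const_pow_of_one_lt 30 (by norm_num : (1 : ℝ) < 16)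
  rcases le_or_gt c 0 with hc | hc
  · exact Eventually.of_forall fun M => (mul_nonpos_of_nonpos_of_nonneg hc (by positivity)).trans (by positivity)
  · have hev := (tendsto_order.1 h).2 c⁻¹ (inv_pos.2 hc)
    filter_upwards [hev] with M hM
    have h16 : (0 : ℝ) < (16 : ℝ) ^ M := by positivity
    rw [div_lt_iff₀ h16] at hM
    calc c * (M : ℝ) ^ 30 ≤ c * (c⁻¹ * (16 : ℝ) ^ M) := mul_le_mul_of_nonneg_left hM.le hc.le
      _ = (16 : ℝ) ^ M := by field_simp

/-- **DGHM20 Proposition 3.1 on `ℤ²` (crude constants), PROVED unconditionally.** For infinitely many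
`u ∈ ℕ` there is an even length `m` with `u ≤ m + 1`, `m ≤ 2(u+1)²` and `u^{-67} μ^m ≤ |WSAP^u_m|`.
[cite: DuminilCopinGangulyHammondManolescu2020, Proposition 3.1] -/
theorem frequently_widePolygons_abundant :
    ∃ᶠ u : ℕ in atTop, ∃ m : ℕ, Even m ∧ u ≤ m + 1 ∧ (m : ℝ) ≤ 2 * ((u : ℝ) + 1) ^ 2 ∧
      (u : ℝ) ^ (-(67 : ℝ)) * Zd.connectiveConstant 2 ^ m ≤ ((widePolygons u m).card : ℝ) := by
  obtain ⟨hμ2, hμ3⟩ := two_le_mu_le_three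
  have hμpos : 0 < Zd.connectiveConstant 2 := by linarith only [hμ2]
  -- the raw composite at `s = 2`, together with `M` large
  have hraw := frequently_sq_lower_le_widePolygons (s := 2) (by norm_num)
  obtain ⟨c₁, hc₁⟩ : ∃ c₁ : ℝ, c₁ = 16 * (6 ^ 2 * 1296 ^ 2 * 9 ^ 4) := ⟨_, rfl⟩
  have hev := eventually_poly_le_sixteen_pow c₁
  have hcomb := hraw.and_eventually (hev.and (eventually_ge_atTop 1))
  -- from frequently-in-`M` to frequently-in-`u`
  rw [frequently_atTop]
  intro a
  obtain ⟨c₂, hc₂⟩ : ∃ c₂ : ℝ, c₂ = 81 * (16 * 3 ^ 2 * 2 * 13 ^ 2 * 1296 ^ 2 * 7 ^ 4) := ⟨_, rfl⟩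
  obtain ⟨U, hU⟩ : ∃ U : ℕ, max c₂ ((2 : ℝ) ^ 66) ≤ U := exists_nat_ge _
  obtain ⟨M, hMA, ⟨u, hu1, hu2, hsq⟩, h16, hM1⟩ :=
    frequently_atTop.1 hcomb ((max a U + 1) ^ 2)
  clear hcomb hev hraw
  -- `u` is large: `u ≥ sqrt(2M+2) ≥ max a U + 1`
  have hularge : max a U + 1 ≤ u := by
    have h1 : (max a U + 1) ^ 2 ≤ 2 * M + 2 := by nlinarith only [hMA]
    have := Nat.sqrt_le_sqrt h1
    rw [Nat.sqrt_eq' (max a U + 1)] at this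
    exact this.trans hu1
  have hua : a ≤ u := by have := le_max_left a U; omega
  have huU : U ≤ u := by have := le_max_right a U; omega
  have hu1R : (1 : ℝ) ≤ u := by exact_mod_cast (show 1 ≤ u by omega)
  have hupos : (0 : ℝ) < u := by linarith only [hu1R]
  have huUR : (U : ℝ) ≤ u := by exact_mod_cast huU
  have huc₂ : c₂ ≤ u := (le_max_left _ _).trans (hU.trans huUR)
  have hu66 : (2 : ℝ) ^ 66 ≤ u := (le_max_right _ _).trans (hU.trans huUR)
  have hM1R : (1 : ℝ) ≤ M := by exact_mod_cast hM1
  have hMpos : (0 : ℝ) < M := by linarith only [hM1R]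
  -- `2M + 2 ≤ (u+1)²`
  have h2M : 2 * (M : ℝ) + 2 ≤ ((u : ℝ) + 1) ^ 2 := by
    have : 2 * M + 2 < (u + 1) ^ 2 := Nat.sqrt_lt'.1 (Nat.lt_succ_of_le hu1)
    have : ((2 * M + 2 : ℕ) : ℝ) ≤ (((u + 1) ^ 2 : ℕ) : ℝ) := by exact_mod_cast this.le
    push_cast at this
    exact this
  refine ⟨u, hua, 2 * (2 * M + 2), ⟨2 * M + 2, by ring⟩, by omega, ?_, ?_⟩
  · push_cast; linarith only [h2M]
  -- the abundance inequality; name the players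
  obtain ⟨W, hW⟩ : ∃ W : ℝ, W = ((widePolygons u (2 * (2 * M + 2))).card : ℝ) := ⟨_, rfl⟩
  obtain ⟨K, hK⟩ : ∃ K : ℝ, K = (2 * (u : ℝ) + 1) * (4 * (2 * (M : ℝ) + 2) + 1) ^ 2 := ⟨_, rfl⟩
  obtain ⟨Lr, hLr⟩ : ∃ Lr : ℝ, Lr = (Nat.log 2 (2 * M + 2 + 1) : ℝ) + 1 := ⟨_, rfl⟩
  obtain ⟨Q, hQ⟩ : ∃ Q : ℝ, Q = (M : ℝ) ^ 24 * 1296 ^ 2 * (4 * (M : ℝ) + 5) ^ 4 := ⟨_, rfl⟩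
  have hW0 : 0 ≤ W := by rw [hW]; exact Nat.cast_nonneg _
  have hLr_pos : 0 < Lr := by rw [hLr]; positivity
  have hQpos : 0 < Q := by rw [hQ]; positivity
  -- real form of the raw inequality: `X² ≤ 8 Lr² (K W + 1)`
  have hrawR : ((M : ℝ) ^ (-(2 * (2 : ℝ) + 8)) / 1296 * Zd.connectiveConstant 2 ^ (2 * M) /
      ((2 * (2 * (M : ℝ) + 2) + 1) ^ 2)) ^ 2 ≤ 8 * Lr ^ 2 * (K * W + 1) := by
    have := hsq
    rw [hLr, hK, hW]
    push_cast at this ⊢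
    linarith only [this]
  clear hsq
  -- `X² = μ^{4M} / Q`
  have hX : ((M : ℝ) ^ (-(2 * (2 : ℝ) + 8)) / 1296 * Zd.connectiveConstant 2 ^ (2 * M) /
      ((2 * (2 * (M : ℝ) + 2) + 1) ^ 2)) ^ 2 = Zd.connectiveConstant 2 ^ (4 * M) / Q := by
    have h24 : ((M : ℝ) ^ (-(2 * (2 : ℝ) + 8))) ^ 2 = ((M : ℝ) ^ 24)⁻¹ := by
      rw [← Real.rpow_natCast, ← Real.rpow_mul hMpos.le,
        show (-(2 * (2 : ℝ) + 8)) * ((2 : ℕ) : ℝ) = -((24 : ℕ) : ℝ) by norm_num,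
        Real.rpow_neg hMpos.le, Real.rpow_natCast]
    have hμ4 : (Zd.connectiveConstant 2 ^ (2 * M)) ^ 2 = Zd.connectiveConstant 2 ^ (4 * M) := by
      rw [← pow_mul]; ring_nf
    rw [div_pow, mul_pow, div_pow, h24, hμ4, hQ]
    have h45 : (2 * (2 * (M : ℝ) + 2) + 1) = 4 * (M : ℝ) + 5 := by ring
    rw [h45]
    have hM24 : (M : ℝ) ^ 24 ≠ 0 := by positivity
    have h45' : (4 * (M : ℝ) + 5) ^ 2 ≠ 0 := by positivity
    field_simp
  -- `16 Lr² Q ≤ 16^M ≤ μ^{4M}`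
  have hLr_le : Lr ≤ 2 * M + 4 := by
    rw [hLr]
    have : (Nat.log 2 (2 * M + 2 + 1) : ℝ) ≤ ((2 * M + 2 + 1 : ℕ) : ℝ) := by
      exact_mod_cast Nat.log_le_self 2 _
    push_cast at this; linarith only [this]
  have hD : 16 * (Lr ^ 2 * Q) ≤ Zd.connectiveConstant 2 ^ (4 * M) := by
    have h1 : Lr ^ 2 ≤ (6 * (M : ℝ)) ^ 2 :=
      pow_le_pow_left₀ hLr_pos.le (by linarith only [hLr_le, hM1R]) 2
    have h2 : (4 * (M : ℝ) + 5) ^ 4 ≤ (9 * (M : ℝ)) ^ 4 :=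
      pow_le_pow_left₀ (by positivity) (by linarith only [hM1R]) 4
    have h3 : 16 * (Lr ^ 2 * Q) ≤ c₁ * (M : ℝ) ^ 30 := by
      rw [hQ]
      calc 16 * (Lr ^ 2 * ((M : ℝ) ^ 24 * 1296 ^ 2 * (4 * (M : ℝ) + 5) ^ 4))
          ≤ 16 * ((6 * (M : ℝ)) ^ 2 * ((M : ℝ) ^ 24 * 1296 ^ 2 * (9 * (M : ℝ)) ^ 4)) := by gcongr
        _ = c₁ * (M : ℝ) ^ 30 := by rw [hc₁]; ring
    have hμ16 : (16 : ℝ) ≤ Zd.connectiveConstant 2 ^ 4 := by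
      have := pow_le_pow_left₀ (by norm_num : (0 : ℝ) ≤ 2) hμ2 4
      norm_num at this; exact this
    have h4 : (16 : ℝ) ^ M ≤ Zd.connectiveConstant 2 ^ (4 * M) := by
      rw [pow_mul]
      exact pow_le_pow_left₀ (by norm_num) hμ16 M
    exact h3.trans (h16.trans h4)
  -- hence `μ^{4M} ≤ 16 Lr² Q · K W`
  have hKW : Zd.connectiveConstant 2 ^ (4 * M) ≤ 16 * (Lr ^ 2 * Q) * (K * W) := by
    rw [hX, div_le_iff₀ hQpos] at hrawR
    have e : 8 * Lr ^ 2 * (K * W + 1) * Q = 8 * ((Lr ^ 2 * Q) * (K * W)) + 8 * (Lr ^ 2 * Q) := by ring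
    rw [e] at hrawR
    have e' : 16 * (Lr ^ 2 * Q) * (K * W) = 16 * ((Lr ^ 2 * Q) * (K * W)) := by ring
    rw [e']
    linarith only [hrawR, hD]
  clear hrawR hX hD h16
  -- the polynomial `16 Lr² Q K ≤ (c₂/81) (u+1)^65`
  have hsq4 : (4 : ℝ) ≤ ((u : ℝ) + 1) ^ 2 := by nlinarith only [hu1R]
  have hMu : (M : ℝ) ≤ ((u : ℝ) + 1) ^ 2 := by linarith only [h2M, hM1R]
  have hpoly : 16 * (Lr ^ 2 * Q) * K ≤ (c₂ / 81) * ((u : ℝ) + 1) ^ 65 := by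
    have e1 : Lr ≤ 3 * ((u : ℝ) + 1) ^ 2 := by linarith only [hLr_le, hMu, hsq4]
    have e2a : (2 * (u : ℝ) + 1) ≤ 2 * ((u : ℝ) + 1) := by linarith only [hu1R]
    have e2b : (4 * (2 * (M : ℝ) + 2) + 1) ≤ 13 * ((u : ℝ) + 1) ^ 2 := by linarith only [hMu, hsq4]
    have e4 : (4 * (M : ℝ) + 5) ≤ 7 * ((u : ℝ) + 1) ^ 2 := by linarith only [hMu, hsq4]
    rw [hQ, hK]
    calc 16 * (Lr ^ 2 * ((M : ℝ) ^ 24 * 1296 ^ 2 * (4 * (M : ℝ) + 5) ^ 4)) *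
          ((2 * (u : ℝ) + 1) * (4 * (2 * (M : ℝ) + 2) + 1) ^ 2)
        ≤ 16 * ((3 * ((u : ℝ) + 1) ^ 2) ^ 2 * ((((u : ℝ) + 1) ^ 2) ^ 24 * 1296 ^ 2 * (7 * ((u : ℝ) + 1) ^ 2) ^ 4)) *
          ((2 * ((u : ℝ) + 1)) * (13 * ((u : ℝ) + 1) ^ 2) ^ 2) := by
          gcongr
      _ = (c₂ / 81) * ((u : ℝ) + 1) ^ 65 := by rw [hc₂]; ring
  -- `2 (u+1)^65 ≤ u^66` (as `u ≥ 2^66`)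
  have hup : 2 * ((u : ℝ) + 1) ^ 65 ≤ (u : ℝ) ^ 66 := by
    have h1 : ((u : ℝ) + 1) ≤ 2 * u := by linarith only [hu1R]
    have h2 : ((u : ℝ) + 1) ^ 65 ≤ (2 * (u : ℝ)) ^ 65 := pow_le_pow_left₀ (by positivity) h1 65
    have hu65 : (0 : ℝ) ≤ (u : ℝ) ^ 65 := by positivity
    calc 2 * ((u : ℝ) + 1) ^ 65 ≤ 2 * (2 * (u : ℝ)) ^ 65 := by linarith only [h2]
      _ = (2 : ℝ) ^ 66 * (u : ℝ) ^ 65 := by ring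
      _ ≤ u * (u : ℝ) ^ 65 := mul_le_mul_of_nonneg_right hu66 hu65
      _ = (u : ℝ) ^ 66 := by ring
  -- assemble: `u^{-67} μ^{4M+4} ≤ W`
  have hμ4 : Zd.connectiveConstant 2 ^ (2 * (2 * M + 2)) =
      Zd.connectiveConstant 2 ^ (4 * M) * Zd.connectiveConstant 2 ^ 4 := by rw [← pow_add]; ring_nf
  have hμ4le : Zd.connectiveConstant 2 ^ 4 ≤ 81 := by
    calc Zd.connectiveConstant 2 ^ 4 ≤ (3 : ℝ) ^ 4 := pow_le_pow_left₀ hμpos.le hμ3 4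
      _ = 81 := by norm_num
  have hu67 : (u : ℝ) ^ (-(67 : ℝ)) = ((u : ℝ) ^ 67)⁻¹ := by
    rw [show (67 : ℝ) = ((67 : ℕ) : ℝ) by norm_num, Real.rpow_neg hupos.le, Real.rpow_natCast]
  have hu67pos : (0 : ℝ) < (u : ℝ) ^ 67 := by positivity
  have hc₂pos : (0 : ℝ) ≤ c₂ / 81 := by rw [hc₂]; positivity
  rw [hu67, hμ4, inv_mul_le_iff₀ hu67pos, ← hW]
  -- `μ^{4M} μ^4 ≤ u^67 W`
  have hP : Zd.connectiveConstant 2 ^ (4 * M) ≤ (c₂ / 81) * ((u : ℝ) ^ 66 / 2) * W := by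
    calc Zd.connectiveConstant 2 ^ (4 * M) ≤ 16 * (Lr ^ 2 * Q) * (K * W) := hKW
      _ = (16 * (Lr ^ 2 * Q) * K) * W := by ring
      _ ≤ ((c₂ / 81) * ((u : ℝ) + 1) ^ 65) * W := mul_le_mul_of_nonneg_right hpoly hW0
      _ ≤ (c₂ / 81) * ((u : ℝ) ^ 66 / 2) * W := by
          apply mul_le_mul_of_nonneg_right _ hW0
          exact mul_le_mul_of_nonneg_left (by linarith only [hup]) hc₂pos
  calc Zd.connectiveConstant 2 ^ (4 * M) * Zd.connectiveConstant 2 ^ 4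
      ≤ ((c₂ / 81) * ((u : ℝ) ^ 66 / 2) * W) * Zd.connectiveConstant 2 ^ 4 :=
        mul_le_mul_of_nonneg_right hP (by positivity)
    _ = ((c₂ / 81) * Zd.connectiveConstant 2 ^ 4) * ((u : ℝ) ^ 66 / 2) * W := by ring
    _ ≤ c₂ * ((u : ℝ) ^ 66 / 2) * W := by
        apply mul_le_mul_of_nonneg_right _ hW0
        apply mul_le_mul_of_nonneg_right _ (by positivity)
        calc c₂ / 81 * Zd.connectiveConstant 2 ^ 4 ≤ c₂ / 81 * 81 := mul_le_mul_of_nonneg_left hμ4le hc₂pos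
          _ = c₂ := by ring
    _ ≤ u * ((u : ℝ) ^ 66 / 2) * W := by
        apply mul_le_mul_of_nonneg_right _ hW0
        exact mul_le_mul_of_nonneg_right huc₂ (by positivity)
    _ = (u : ℝ) ^ 67 * W / 2 := by ring
    _ ≤ (u : ℝ) ^ 67 * W := by
        have : 0 ≤ (u : ℝ) ^ 67 * W := mul_nonneg hu67pos.le hW0
        linarith only [this]

end Literature.Probability.RandomPlanarGeometry.SAW
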